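import Summits.Ventures.PackingBounds.ThreePointCert.G27CertC

/-!
# A(10, arccos 1/10) ≤ 26: kernel instance of the exact value-27 three-point certificate — kernel validation of sum-of-squares rows (file 6)

Framing: lottery ticket; floor = certified bounds/negative ranges. Venture `PackingBounds` (cell
`pub-packcert`), recognition seat (T5: the ghost `srg(27, 20, 29/2, 15)`), three-point SDP family's exact
kernel format. Integer data of an EXACT (slack-free) Bachoc–Vallentin certificate of value exactly `27` for
`A(10, arccos 1/10)` (n = 10, s = 1/10, degree 6, symmetric sums of squares of Machado–de Oliveira Filho
type, `B = 0`; every block on the optimal face complementary to the ghost pseudo-configuration), produced by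
`pub-packcert-recog` gen 16 (`code/t5/kernel/job3.py` + `job4b.py`, the latter = `pub-packcert-lp` gen 4's
`job4.py` adapted) in the units of the kernel checker `ThreePointCert.CheckExact` (soundness
`ThreePointCert.SoundExact*`, built by `pub-packcert-lp` gen 4 for `A(9, arccos 1/3) ≤ 98`). Generated file:
plain lists of integers / monomials.
-/

namespace Summit.Ventures.PackingBounds.ThreePointCert.G27

open Literature.Geometry.DiscreteGeometry Literature.Geometry.DiscreteGeometry.PolyCert PolyCert.SPoly

set_option maxHeartbeats 0 in
/-- Part `pR0std`: rows [23, 27) added to `d0_6` give `eTOT0` (kernel; est. 2304 term products). -/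
theorem ok_pR0std_4 : partChunkOK G27.pR0std 23 4 G27.d0_6 G27.eTOT0 = true := by
  decide +kernel

set_option maxHeartbeats 0 in
/-- Part `pR1trv`: rows [0, 16) added to `([] : SPoly)` give `d1_1` (kernel; est. 3136 term products). -/
theorem ok_pR1trv_1 : partChunkOK G27.pR1trv 0 16 ([] : SPoly) G27.d1_1 = true := by
  decide +kernel

set_option maxHeartbeats 0 in
/-- Part `pR1alt`: rows [0, 4) added to `d1_1` give `d1_2` (kernel; est. 576 term products). -/
theorem ok_pR1alt_1 : partChunkOK G27.pR1alt 0 4 G27.d1_1 G27.d1_2 = true := by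
  decide +kernel

set_option maxHeartbeats 0 in
/-- Part `pR1std`: rows [0, 18) added to `d1_2` give `eTOT1` (kernel; est. 7200 term products). -/
theorem ok_pR1std_1 : partChunkOK G27.pR1std 0 18 G27.d1_2 G27.eTOT1 = true := by
  decide +kernel

end Summit.Ventures.PackingBounds.ThreePointCert.G27
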